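import Summits.CriticalPhenomena.SAWScalingLimit.Theorems.AvoidanceLimit.Negative.AvoidanceLimitStaircase

/-!
# Negative knowledge on crux `AvoidanceLimit`, part 8: square and disc — no probability-zero kill

Support file (refuter / cdisprove lane, cycle 3) for the crux
`Summit.CriticalPhenomena.SAWScalingLimit.Theses.SAWLoopFugacityFlow.AvoidanceLimit`
(stmt-CriticalPhenomena-10649, route SAWLoopFugacityFlow, rank 2). The square `bigSq = (-2,2)²`
marked at `±2` has axis caps (`bigSq_vertStable`, `bigSq_axisInterval`, `bigSq_axis`), so part 7's
endpoint transfer applies: `isEndpointApprox_of_hull_bigSq` — every endpoint approximation of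
`(bigSq; 2, -2)` IS an endpoint approximation of each Dobrushin `D'` with the same marked points
agreeing with `bigSq` in balls around `±2`; likewise `isEndpointApprox_of_hull_unitDisc` for the
tree's `DobrushinDomain.unitDisc = (𝔻; 1, -1)`. Consequences: `eventually_pos_bigSq` — NO
probability-zero kill of the crux (criterion `not_avoidanceLimit_of_frequently_zero`, part 6) exists
in the square, for any hull subdomain and ANY endpoint approximation (mesoscopic depth, tangential
approach, … included), unconditionally; the general endpoint transfer (all Jordan `D`, kept as the
HYPOTHESIS of `eventually_pos_of_endpointTransfer` with a paper proof sketch in its docstring — the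
lattice-topology content of the route's "largest-component bookkeeping", which makes the double
hypothesis of `IsingBoundaryRatio` redundant for `D = bigSq`; the IsingBoundaryRatio work file's remark that the INNER approximation is
load-bearing "for comb-like `D'`" needs corridors of length `≥ ε` accumulating at `a`, which the
ball agreement copies into `D` and the Jordan property of `D` forbids); and `avoidanceLimit_window` — under the crux, for every hull
subdomain `D' ≠ D` of every `D`, `c ≤ P_δ ≤ 1 - c` eventually (generalising part 5's strip window).
[folklore]
-/

noncomputable section

open Set Filter Topology MeasureTheory Complex Metric
open UpperHalfPlane (upperHalfPlaneSet isOpen_upperHalfPlaneSet)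
open Literature.Probability.RandomPlanarGeometry Literature.Probability.LatticeModels
open Summit.CriticalPhenomena.SAWScalingLimit.Theses.SAWLoopFugacityFlow (AvoidanceLimit)
open Summit.CriticalPhenomena.SAWScalingLimit.Theorems.IsingBoundaryRatio.Negative
  (mem_meshDomain_of_reachable_ne eventually_ne)
open scoped ENNReal

namespace Summit.CriticalPhenomena.SAWScalingLimit.Theorems.AvoidanceLimit.Negative

section Square


/-- The marked points `±2` of `bigSq` are real. [folklore] -/
theorem bigSq_pt_im (i : Fin 2) : (bigSq.pt i).im = 0 := by
  fin_cases i
  · simp [bigSq_pt_zero]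
  · simp [bigSq_pt_one]

/-- The marked points `±2` of `bigSq` have real part `±2`. [folklore] -/
theorem bigSq_pt_re_abs (i : Fin 2) : |(bigSq.pt i).re| = 2 := by
  fin_cases i
  · simp [bigSq_pt_zero]
  · simp [bigSq_pt_one]

/-- The square near its marked points is stable under vertical shrinking towards the axis.
[folklore] -/
theorem bigSq_vertStable (i : Fin 2) :
    ∀ z ∈ bigSq.carrier ∩ ball (bigSq.pt i) 1, ∀ w : ℂ, w.re = z.re → |w.im| ≤ |z.im| →
      w ∈ bigSq.carrier ∩ ball (bigSq.pt i) 1 := by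
  refine vertStable_inter_ball (bigSq_pt_im i) 1 ?_
  rintro z hz w hre him
  rw [bigSq_carrier, mem_symRect] at hz ⊢
  rw [abs_le] at him
  obtain ⟨⟨h1, h2⟩, h3, h4⟩ := hz
  refine ⟨⟨by rw [hre]; exact h1, by rw [hre]; exact h2⟩, ?_, ?_⟩
  · rcases le_or_gt 0 z.im with hz0 | hz0
    · rw [abs_of_nonneg hz0] at him; linarith
    · rw [abs_of_neg hz0] at him; linarith
  · rcases le_or_gt 0 z.im with hz0 | hz0
    · rw [abs_of_nonneg hz0] at him; linarith
    · rw [abs_of_neg hz0] at him; linarith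

/-- The square near its marked points meets the axis in an interval. [folklore] -/
theorem bigSq_axisInterval (i : Fin 2) :
    ∀ z₁ ∈ bigSq.carrier ∩ ball (bigSq.pt i) 1, ∀ z₂ ∈ bigSq.carrier ∩ ball (bigSq.pt i) 1,
      z₁.im = 0 → z₂.im = 0 → ∀ w : ℂ, w.im = 0 → z₁.re ≤ w.re → w.re ≤ z₂.re →
      w ∈ bigSq.carrier ∩ ball (bigSq.pt i) 1 := by
  refine axisInterval_inter_ball (bigSq_pt_im i) 1 ?_
  rintro z₁ hz₁ z₂ hz₂ - - w hw hle₁ hle₂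
  rw [bigSq_carrier, mem_symRect] at hz₁ hz₂ ⊢
  refine ⟨⟨by linarith [hz₁.1.1], by linarith [hz₂.1.2]⟩, by rw [hw]; norm_num, by rw [hw]; norm_num⟩

/-- Axis points of the square accumulate at its marked points. [folklore] -/
theorem bigSq_axis (i : Fin 2) (ε : ℝ) (hε : 0 < ε) :
    ∃ x : ℝ, (x : ℂ) ∈ bigSq.carrier ∧ dist (x : ℂ) (bigSq.pt i) < ε := by
  set t : ℝ := min ε 1 / 2 with ht
  have ht0 : 0 < t := by positivity
  have ht1 : t ≤ 1 / 2 := by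
    have := min_le_right ε 1; rw [ht]; linarith
  have htε : t < ε := by
    have := min_le_left ε 1; rw [ht]; linarith
  fin_cases i
  · refine ⟨2 - t, ?_, ?_⟩
    · rw [bigSq_carrier, mem_symRect]
      simp only [Complex.ofReal_re, Complex.ofReal_im]
      exact ⟨⟨by linarith, by linarith⟩, by norm_num, by norm_num⟩
    · show dist ((2 - t : ℝ) : ℂ) (bigSq.pt 0) < ε
      rw [bigSq_pt_zero, Complex.dist_eq]
      have : ((2 - t : ℝ) : ℂ) - 2 = ((-t : ℝ) : ℂ) := by push_cast; ring
      rw [this, Complex.norm_real, Real.norm_eq_abs, abs_neg, abs_of_pos ht0]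
      exact htε
  · refine ⟨-2 + t, ?_, ?_⟩
    · rw [bigSq_carrier, mem_symRect]
      simp only [Complex.ofReal_re, Complex.ofReal_im]
      exact ⟨⟨by linarith, by linarith⟩, by norm_num, by norm_num⟩
    · show dist ((-2 + t : ℝ) : ℂ) (bigSq.pt 1) < ε
      rw [bigSq_pt_one, Complex.dist_eq]
      have : ((-2 + t : ℝ) : ℂ) - (-2) = ((t : ℝ) : ℂ) := by push_cast; ring
      rw [this, Complex.norm_real, Real.norm_eq_abs, abs_of_pos ht0]
      exact htε

/-- **Endpoint transfer in the reference square**: every endpoint approximation of `(bigSq; 2, -2)`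
is one of each Dobrushin `D'` with the same marked points agreeing with `bigSq` in balls around `±2`.
So the double hypothesis `IsEndpointApprox D a b ∧ IsEndpointApprox D' a b` of the route's
`IsingBoundaryRatio` is redundant for `D = bigSq`, and corner-germ's `stub_cornerIdentification`
gets its first clause for free there. [folklore] -/
theorem isEndpointApprox_of_hull_bigSq {D' : DobrushinDomain} {a b : ℝ → Site 2}
    (hab : SAW.IsEndpointApprox bigSq a b)
    (h0 : D'.pt 0 = bigSq.pt 0) (h1 : D'.pt 1 = bigSq.pt 1)
    (hball : ∃ ε : ℝ, 0 < ε ∧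
      D'.carrier ∩ ball (bigSq.pt 0) ε = bigSq.carrier ∩ ball (bigSq.pt 0) ε ∧
      D'.carrier ∩ ball (bigSq.pt 1) ε = bigSq.carrier ∩ ball (bigSq.pt 1) ε) :
    SAW.IsEndpointApprox D' a b :=
  isEndpointApprox_of_hull_of_axisCaps hab h0 h1 hball bigSq_pt_im ⟨1, one_pos, bigSq_vertStable⟩
    ⟨1, one_pos, bigSq_axisInterval⟩ bigSq_axis

/-- **No probability-zero kill in the reference square.** For every hull subdomain `D'` of
`bigSq` and EVERY endpoint approximation, eventually `P_δ(range γ_δ ⊆ closure D') > 0`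
(unconditionally: no SAW estimate involved). [folklore] -/
theorem eventually_pos_bigSq {D' : DobrushinDomain} {a b : ℝ → Site 2}
    (hab : SAW.IsEndpointApprox bigSq a b) (hsub : D'.carrier ⊆ bigSq.carrier)
    (h0 : D'.pt 0 = bigSq.pt 0) (h1 : D'.pt 1 = bigSq.pt 1)
    (hball : ∃ ε : ℝ, 0 < ε ∧
      D'.carrier ∩ ball (bigSq.pt 0) ε = bigSq.carrier ∩ ball (bigSq.pt 0) ε ∧
      D'.carrier ∩ ball (bigSq.pt 1) ε = bigSq.carrier ∩ ball (bigSq.pt 1) ε) :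
    ∀ᶠ δ in 𝓝[>] (0 : ℝ), 0 < ((SAW.law bigSq.carrier δ (a δ) (b δ)).map (fun γ ↦ γ.curve))
      (CurveClass.rangeSubset (closure D'.carrier)) :=
  eventually_map_law_rangeSubset_pos hab (isEndpointApprox_of_hull_bigSq hab h0 h1 hball) hsub

end Square

/-! ### The unit disc has axis caps -/

section Disc

open DobrushinDomain (unitDisc)

/-- The marked points `1, -1` of the tree's `DobrushinDomain.unitDisc` are real. [folklore] -/
theorem unitDisc_pt_im (i : Fin 2) : (unitDisc.pt i).im = 0 := by
  have h0 : unitDisc.pt 0 = 1 := by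
    change circleMap 0 1 (2 * Real.pi * 0) = 1
    simp [circleMap]
  have h1 : unitDisc.pt 1 = -1 := by
    change circleMap 0 1 (2 * Real.pi * (1 / 2 : ℝ)) = -1
    rw [show 2 * Real.pi * (1 / 2 : ℝ) = Real.pi by ring]
    simp [circleMap, Complex.exp_pi_mul_I]
  fin_cases i
  · simp [h0]
  · simp [h1]

/-- The open unit disc is stable under vertical shrinking towards the axis. [folklore] -/
theorem ball_zero_vertStable : ∀ z ∈ Metric.ball (0 : ℂ) 1, ∀ w : ℂ, w.re = z.re →
    |w.im| ≤ |z.im| → w ∈ Metric.ball (0 : ℂ) 1 := by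
  intro z hz w hre him
  have h := vertStable_inter_ball (W := univ) (p := (0 : ℂ)) (by simp) 1
    (fun _ _ _ _ _ ↦ mem_univ _) z ⟨mem_univ _, hz⟩ w hre him
  exact h.2

/-- The open unit disc meets the axis in an interval. [folklore] -/
theorem ball_zero_axisInterval : ∀ z₁ ∈ Metric.ball (0 : ℂ) 1, ∀ z₂ ∈ Metric.ball (0 : ℂ) 1,
    z₁.im = 0 → z₂.im = 0 → ∀ w : ℂ, w.im = 0 → z₁.re ≤ w.re → w.re ≤ z₂.re →
    w ∈ Metric.ball (0 : ℂ) 1 := by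
  intro z₁ hz₁ z₂ hz₂ h₁ h₂ w hw hle₁ hle₂
  have h := axisInterval_inter_ball (W := univ) (p := (0 : ℂ)) (by simp) 1
    (fun _ _ _ _ _ _ _ _ _ _ ↦ mem_univ _) z₁ ⟨mem_univ _, hz₁⟩ z₂ ⟨mem_univ _, hz₂⟩ h₁ h₂ w hw
    hle₁ hle₂
  exact h.2

/-- **Endpoint transfer in the unit disc**: every endpoint approximation of the tree's
`DobrushinDomain.unitDisc = (𝔻; 1, -1)` is one of each Dobrushin `D'` with the same marked points
agreeing with the disc in balls around `±1`. [folklore] -/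
theorem isEndpointApprox_of_hull_unitDisc {D' : DobrushinDomain} {a b : ℝ → Site 2}
    (hab : SAW.IsEndpointApprox unitDisc a b)
    (h0 : D'.pt 0 = unitDisc.pt 0) (h1 : D'.pt 1 = unitDisc.pt 1)
    (hball : ∃ ε : ℝ, 0 < ε ∧
      D'.carrier ∩ ball (unitDisc.pt 0) ε = unitDisc.carrier ∩ ball (unitDisc.pt 0) ε ∧
      D'.carrier ∩ ball (unitDisc.pt 1) ε = unitDisc.carrier ∩ ball (unitDisc.pt 1) ε) :
    SAW.IsEndpointApprox D' a b := by
  have hcar : unitDisc.carrier = Metric.ball (0 : ℂ) 1 := rfl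
  have hpt0 : unitDisc.pt 0 = 1 := by
    change circleMap 0 1 (2 * Real.pi * 0) = 1
    simp [circleMap]
  have hpt1 : unitDisc.pt 1 = -1 := by
    change circleMap 0 1 (2 * Real.pi * (1 / 2 : ℝ)) = -1
    rw [show 2 * Real.pi * (1 / 2 : ℝ) = Real.pi by ring]
    simp [circleMap, Complex.exp_pi_mul_I]
  refine isEndpointApprox_of_hull_of_axisCaps hab h0 h1 hball unitDisc_pt_im ⟨1, one_pos, ?_⟩
    ⟨1, one_pos, ?_⟩ ?_
  · intro i
    rw [hcar]
    exact vertStable_inter_ball (unitDisc_pt_im i) 1 ball_zero_vertStable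
  · intro i
    rw [hcar]
    exact axisInterval_inter_ball (unitDisc_pt_im i) 1 ball_zero_axisInterval
  · intro i ε hε
    set t : ℝ := min ε 1 / 2 with ht
    have ht0 : 0 < t := by positivity
    have ht1 : t ≤ 1 / 2 := by
      have := min_le_right ε 1; rw [ht]; linarith
    have htε : t < ε := by
      have := min_le_left ε 1; rw [ht]; linarith
    fin_cases i
    · refine ⟨1 - t, ?_, ?_⟩
      · rw [hcar, Metric.mem_ball, dist_zero_right, Complex.norm_real, Real.norm_eq_abs,
          abs_of_pos (by linarith)]
        linarith
      · show dist ((1 - t : ℝ) : ℂ) (unitDisc.pt 0) < ε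
        rw [hpt0, Complex.dist_eq]
        have : ((1 - t : ℝ) : ℂ) - 1 = ((-t : ℝ) : ℂ) := by push_cast; ring
        rw [this, Complex.norm_real, Real.norm_eq_abs, abs_neg, abs_of_pos ht0]
        exact htε
    · refine ⟨-1 + t, ?_, ?_⟩
      · rw [hcar, Metric.mem_ball, dist_zero_right, Complex.norm_real, Real.norm_eq_abs,
          abs_of_neg (by linarith)]
        linarith
      · show dist ((-1 + t : ℝ) : ℂ) (unitDisc.pt 1) < ε
        rw [hpt1, Complex.dist_eq]
        have : ((-1 + t : ℝ) : ℂ) - (-1) = ((t : ℝ) : ℂ) := by push_cast; ring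
        rw [this, Complex.norm_real, Real.norm_eq_abs, abs_of_pos ht0]
        exact htε

end Disc

/-! ### The general endpoint transfer as a hypothesis, and the window under the crux -/

/-- **ENDPOINT TRANSFER, general form (open lattice topology; hypothesis `hT` below).** Every
endpoint approximation of `(D; a, b)` should be one of each hull subdomain `D'` (inline hypotheses of
the crux) for EVERY Jordan `D` — PROVED for domains with axis caps (`isEndpointApprox_of_hull_of_axisCaps`,
part 7; instances `bigSq`, `unitDisc` above), recorded here only as the hypothesis `hT` (deliberately
not a named `Prop`: it is a lattice-topology lemma owed by provers, not a literature fact). It is the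
content hidden in the route's "largest-component bookkeeping" (corner-germ `stub_cornerIdentification`,
first clause; the route item `IsingBoundaryRatio` ASSUMES both approximations instead). Paper proof
for Jordan `D` (sketch): by Carathéodory, `a` has prime-end neighbourhoods `W_k ↓ {a}` cut off by
circular crosscuts `Q_k`; for small `δ`, `a_δ ∈ W_{k+1}` and any `Ω_δ`-path from `a_δ` to the bulk
crosses the fixed region `A_k = W_k ∖ cl W_{k+1} ⊆ B(a, ε/2)` from `Q_{k+1}` to `Q_k`; a crossing
lattice corridor of `A_k` that is lattice-separated (inside the ball) from a fixed compact `K ⊆ A_k`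
for infinitely many `δ_n → 0` forces boundary detours of `∂D` of diameter `≥ dist(Q_k, Q_{k+1})`
accumulating on a limit arc — a convergence continuum, excluded by local connectivity of the Jordan
curve `∂D`. **Under it, no probability-zero kill exists anywhere**: eventually
`P_δ(range γ_δ ⊆ closure D') > 0` along every datum of the crux. [folklore] -/
theorem eventually_pos_of_endpointTransfer
    (hT : ∀ (D D' : DobrushinDomain) (a b : ℝ → Site 2), SAW.IsEndpointApprox D a b →
      D'.carrier ⊆ D.carrier → D'.pt 0 = D.pt 0 → D'.pt 1 = D.pt 1 →
      (∃ ε : ℝ, 0 < ε ∧ D'.carrier ∩ ball (D.pt 0) ε = D.carrier ∩ ball (D.pt 0) ε ∧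
        D'.carrier ∩ ball (D.pt 1) ε = D.carrier ∩ ball (D.pt 1) ε) →
      SAW.IsEndpointApprox D' a b)
    {D D' : DobrushinDomain}
    {a b : ℝ → Site 2} (hab : SAW.IsEndpointApprox D a b) (hsub : D'.carrier ⊆ D.carrier)
    (h0 : D'.pt 0 = D.pt 0) (h1 : D'.pt 1 = D.pt 1)
    (hball : ∃ ε : ℝ, 0 < ε ∧ D'.carrier ∩ ball (D.pt 0) ε = D.carrier ∩ ball (D.pt 0) ε ∧
      D'.carrier ∩ ball (D.pt 1) ε = D.carrier ∩ ball (D.pt 1) ε) :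
    ∀ᶠ δ in 𝓝[>] (0 : ℝ), 0 < ((SAW.law D.carrier δ (a δ) (b δ)).map (fun γ ↦ γ.curve))
      (CurveClass.rangeSubset (closure D'.carrier)) :=
  eventually_map_law_rangeSubset_pos hab (hT D D' a b hab hsub h0 h1 hball) hsub

/-- **The window under the crux** (generalises cycle 2's `avoidanceLimit_strip_window` to every
hull subdomain `D' ≠ D`): for some `c > 0` and all small `δ`, `c ≤ P_δ(range ⊆ closure D') ≤ 1 - c`.
Any refutation must violate one of the two bounds frequently; any proof must establish both (an
`O(1)` confinement cost and a uniformly positive escape probability at `x_c`). [folklore] -/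
theorem avoidanceLimit_window (h : AvoidanceLimit) {D D' : DobrushinDomain}
    {a b : ℝ → Site 2} (hab : SAW.IsEndpointApprox D a b) (hsub : D'.carrier ⊆ D.carrier)
    (h0 : D'.pt 0 = D.pt 0) (h1 : D'.pt 1 = D.pt 1)
    (hball : ∃ ε : ℝ, 0 < ε ∧ D'.carrier ∩ ball (D.pt 0) ε = D.carrier ∩ ball (D.pt 0) ε ∧
      D'.carrier ∩ ball (D.pt 1) ε = D.carrier ∩ ball (D.pt 1) ε)
    (hne : (D.carrier \ D'.carrier).Nonempty) :
    ∃ c : ℝ, 0 < c ∧ ∀ᶠ δ in 𝓝[>] (0 : ℝ),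
      ENNReal.ofReal c ≤ ((SAW.law D.carrier δ (a δ) (b δ)).map (fun γ ↦ γ.curve))
        (CurveClass.rangeSubset (closure D'.carrier)) ∧
      ((SAW.law D.carrier δ (a δ) (b δ)).map (fun γ ↦ γ.curve))
        (CurveClass.rangeSubset (closure D'.carrier)) ≤ ENNReal.ofReal (1 - c) := by
  obtain ⟨φ, hφ⟩ := MarkedDomain.exists_isChordalUniformizing_holds D
  have hstar : IsStarHull (φ.pullbackHull D') :=
    IsStarHull.pullbackHull JordanDomain.isSimplyConnected_holds hφ
      (isHullSubdomain_of_ball hsub h0 h1 hball)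
  obtain ⟨Φ, hΦ, -⟩ := IsStarHull.existsUnique_isRestrictionMap_holds hstar
  obtain ⟨d, hd0, -, hd⟩ := IsStarHull.exists_hasRestrictionDeriv_holds hstar hΦ
  obtain ⟨w, hw, hw'⟩ := hne
  have hd1 : d < 1 := restrictionDeriv_lt_one hstar hΦ hd (pullbackHull_inter_nonempty φ hw hw')
  have hT := h D D' a b hab hsub h0 h1 hball φ hφ _ rfl Φ d hΦ hd
  set L : ℝ := d ^ ((5 : ℝ) / 8) with hL
  have hL0 : 0 < L := Real.rpow_pos_of_pos hd0 _
  have hL1 : L < 1 := Real.rpow_lt_one hd0.le hd1 (by norm_num)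
  set c : ℝ := min (L / 2) ((1 - L) / 2) with hc
  have hc0 : 0 < c := lt_min (by linarith) (by linarith)
  have hcL : c < L := lt_of_le_of_lt (min_le_left _ _) (by linarith)
  have hLc : L < 1 - c := by
    have : c ≤ (1 - L) / 2 := min_le_right _ _
    linarith
  refine ⟨c, hc0, ?_⟩
  have hlo := (tendsto_order.1 hT).1 _ ((ENNReal.ofReal_lt_ofReal_iff hL0).2 hcL)
  have hhi := (tendsto_order.1 hT).2 _ ((ENNReal.ofReal_lt_ofReal_iff (by linarith)).2 hLc)
  filter_upwards [hlo, hhi] with δ hδ1 hδ2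
  exact ⟨hδ1.le, hδ2.le⟩

end Summit.CriticalPhenomena.SAWScalingLimit.Theorems.AvoidanceLimit.Negative

end
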